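import Literature.AlgebraicGeometry.Resolution.ProjectiveModels
import HarnessLib

/-!
# Proper models of a function field, their centres, and Zariski's patching of a resolving system

Topic: `Literature/AlgebraicGeometry/Resolution`. The PROPER-model twin of `ProjectiveModels.lean`
(Zariski–Samuel II, Ch. VI §17: complete models; Piltant 2013, §2: "proper model `X/k` of `K`",
Axiom 5 and the gluing in the proof of Prop. 5.1, Step 5, whose output "glue along … to a proper
model `Y/k` of `K`" is proper, not projective). Everything here is PROVED, verbatim from the
projective case except that properness of the structure morphism is a field of the structure
instead of a consequence of projectivity:

* `ProperModel k K` — a `KModel k K` (`ValuationCentre.lean`) whose scheme is integral and PROPER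
  over `k`, whose `K`-point is the generic point and identifies `K` with the function field.
  `ProjModel.toProperModel` forgets projectivity.
* `ProperModel.centre`, `RegCentre`, `Hom`, `Hom.comp`, `Hom.id`, `Hom.map_centre`, `Hom.RegLe`,
  `RegCentre.of_hom`, `isRegular_of_forall_regCentre`, `Hom.exists_isIso_morphismRestrict`
  (a morphism of proper models is birational), `Hom.hasResolution` — as for `ProjModel`.
* `exists_hom_forall_regCentre` — **Zariski's patching of a finite resolving system from the
  WEAK two-model step** (Zariski–Samuel II, Ch. VI §17; Piltant 2013, Cor. 5.7): if for any two
  proper models `M₁, M₂` there is a proper model `N → M₁` on which every valuation with a regular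
  centre on `M₁` OR on `M₂` has a regular centre, then every proper model `M₀` is dominated by a
  proper model on which every valuation regular on `M₀` or on some member of a given finite list is
  regular; `hasResolution_of_resolvingSystem` — hence `M₀` has a resolution of singularities when
  the list is a resolving system; `exists_hom_forall_regCentre_of_regLe` — the two-model step in
  Piltant's `RegLe` form (`N → Mᵢ` with `φᵢ⁻¹(Reg Mᵢ) ⊆ Reg N`) implies the weak step.

## References

* O. Zariski, P. Samuel, *Commutative Algebra* II, Ch. VI §17. [ZariskiSamuel1960]
* O. Piltant, *An axiomatic version of Zariski's patching theorem*, RACSAM 107 (2013) 91–121,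
  §2 (proper models, centres), Prop. 5.1 (proof, Step 5), Cor. 5.7. [Piltant2013]
-/

noncomputable section

open CategoryTheory AlgebraicGeometry TopologicalSpace IsLocalRing

namespace Literature.AlgebraicGeometry.Resolution

universe u

/-- A **proper model of `K` over `k`** (Zariski–Samuel II, Ch. VI §17: complete models;
Piltant 2013, §2: "proper model `X/k` of `K`"): a `k`-scheme `π : X → Spec k` with a `K`-point
`gen : Spec K → X` over `k` such that `X` is integral, `π` is proper, `gen` hits the generic point
and `𝒪_{X,ξ} → K` is an isomorphism. [cite: ZariskiSamuel1960, Ch. VI §17] -/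
structure ProperModel (k K : Type u) [Field k] [Field K] [Algebra k K] extends KModel k K where
  /-- The underlying scheme is integral. -/
  isIntegral : IsIntegral X
  /-- `X → Spec k` is proper. -/
  isProper : IsProper π
  /-- The distinguished `K`-point is the generic point. -/
  genericPt_eq : gen (closedPoint K) = genericPoint X
  /-- `K` is the function field: `𝒪_{X,ξ} → K` is an isomorphism. -/
  isIso_stalkClosedPointTo : IsIso (Scheme.stalkClosedPointTo gen)

/-- A projective model is a proper model. [folklore] -/
def ProjModel.toProperModel {k K : Type u} [Field k] [Field K] [Algebra k K] (M : ProjModel k K) :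
    ProperModel k K where
  toKModel := M.toKModel
  isIntegral := M.isIntegral
  isProper := M.isProjectiveOver.isProper
  genericPt_eq := M.genericPt_eq
  isIso_stalkClosedPointTo := M.isIso_stalkClosedPointTo

namespace ProperModel

variable {k K : Type u} [Field k] [Field K] [Algebra k K]

/-- The underlying scheme of a proper model is integral. [folklore] -/
instance isIntegral' (M : ProperModel k K) : IsIntegral M.X := M.isIntegral

/-- `𝒪_{X,ξ} → K` is an isomorphism. [folklore] -/
instance isIso_stalkClosedPointTo' (M : ProperModel k K) :
    IsIso (Scheme.stalkClosedPointTo M.gen) := M.isIso_stalkClosedPointTo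

/-- The structure morphism of a proper model is proper. [folklore] -/
instance isProper' (M : ProperModel k K) : IsProper M.π := M.isProper

/-- A proper model is locally Noetherian (of finite type over a field). [folklore] -/
instance isLocallyNoetherian (M : ProperModel k K) : IsLocallyNoetherian M.X :=
  LocallyOfFiniteType.isLocallyNoetherian M.π

/-- A proper model is quasi-compact. [folklore] -/
instance compactSpace (M : ProperModel k K) : CompactSpace M.X :=
  QuasiCompact.compactSpace_of_compactSpace M.π

/-- A proper model is Noetherian. [folklore] -/
instance isNoetherian (M : ProperModel k K) : IsNoetherian M.X := {}

/-- The distinguished point of the underlying `KModel` is the generic point. [folklore] -/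
theorem genericPt_eq' (M : ProperModel k K) : M.toKModel.genericPt = genericPoint M.X :=
  M.genericPt_eq

/-- The underlying `KModel` of the proper model of a projective model. [folklore] -/
@[simp] theorem _root_.Literature.AlgebraicGeometry.Resolution.ProjModel.toProperModel_toKModel
    (M : ProjModel k K) : M.toProperModel.toKModel = M.toKModel := rfl

/-! ## The centre of a valuation -/

/-- **The centre** of `𝒪_v ∈ Zar(K/k)` on the proper model `M` (exists by properness,
`KModel.exists_isCentre`; Piltant 2013, §2: "for any proper model `X/k` of `K`, `V` has a unique
center `x_V ∈ X`"). [cite: ZariskiSamuel1960, Ch. VI §17] -/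
def centre (M : ProperModel k K) (v : ZariskiRiemannSpace k K) : M.X :=
  (M.toKModel.exists_isCentre v).choose

/-- The centre is a centre. [folklore] -/
theorem isCentre_centre (M : ProperModel k K) (v : ZariskiRiemannSpace k K) :
    M.IsCentre v (M.centre v) :=
  (M.toKModel.exists_isCentre v).choose_spec

/-- Uniqueness: every centre of `v` on `M` is `M.centre v` (separatedness). [folklore] -/
theorem eq_centre_of_isCentre {M : ProperModel k K} {v : ZariskiRiemannSpace k K} {x : M.X}
    (hx : M.IsCentre v x) : x = M.centre v :=
  hx.unique (M.isCentre_centre v)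

/-- **`v` has a regular centre on `M`** (Piltant 2013, Axiom 5: `x_V ∈ Reg(X)`).
[cite: ZariskiSamuel1960, Ch. VI §17] -/
def RegCentre (M : ProperModel k K) (v : ZariskiRiemannSpace k K) : Prop :=
  IsRegularLocalRing (M.X.presheaf.stalk (M.centre v))

/-- `RegCentre` via any centre. [folklore] -/
theorem regCentre_iff {M : ProperModel k K} {v : ZariskiRiemannSpace k K} :
    M.RegCentre v ↔ ∃ x : M.X, M.IsCentre v x ∧ IsRegularLocalRing (M.X.presheaf.stalk x) := by
  constructor
  · exact fun h => ⟨_, M.isCentre_centre v, h⟩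
  · rintro ⟨x, hx, hreg⟩
    rw [eq_centre_of_isCentre hx] at hreg
    exact hreg

/-- The centre of `v` on a projective model is its centre on the associated proper model.
[folklore] -/
theorem _root_.Literature.AlgebraicGeometry.Resolution.ProjModel.toProperModel_centre
    (M : ProjModel k K) (v : ZariskiRiemannSpace k K) :
    M.toProperModel.centre v = M.centre v :=
  ProjModel.eq_centre_of_isCentre (M.toProperModel.isCentre_centre v)

/-- Regular centres on a projective model are regular centres on the associated proper model.
[folklore] -/
theorem _root_.Literature.AlgebraicGeometry.Resolution.ProjModel.toProperModel_regCentre_iff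
    (M : ProjModel k K) (v : ZariskiRiemannSpace k K) :
    M.toProperModel.RegCentre v ↔ M.RegCentre v := by
  unfold RegCentre ProjModel.RegCentre
  rw [ProjModel.toProperModel_centre]
  exact Iff.rfl

/-- **A proper model all of whose centres are regular is a regular scheme** (every point of an
integral model is a centre, `KModel.exists_isCentre_of_isGenericPoint`; Piltant 2013, Cor. 5.7).
[cite: ZariskiSamuel1960, Ch. VI §17] -/
theorem isRegular_of_forall_regCentre {M : ProperModel k K} (h : ∀ v, M.RegCentre v) :
    Scheme.IsRegular M.X := by
  intro x
  have hgen : IsGenericPoint M.toKModel.genericPt (Set.univ : Set M.X) := by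
    rw [M.genericPt_eq']
    exact genericPoint_spec M.X
  obtain ⟨v, hv⟩ := M.toKModel.exists_isCentre_of_isGenericPoint hgen x
  rw [eq_centre_of_isCentre hv]
  exact h v

/-! ## Morphisms of models -/

/-- A **morphism of proper models** of `K/k` (`KModel.Hom`). [cite: ZariskiSamuel1960, Ch. VI §17] -/
abbrev Hom (N M : ProperModel k K) : Type u :=
  KModel.Hom N.toKModel M.toKModel

variable {L N M : ProperModel k K}

/-- The identity morphism of a proper model. [folklore] -/
def Hom.id (M : ProperModel k K) : Hom M M where
  f := 𝟙 M.X
  f_π := Category.id_comp _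
  gen_f := Category.comp_id _

/-- The underlying morphism of the identity. [folklore] -/
@[simp] theorem Hom.id_f (M : ProperModel k K) : (Hom.id M).f = 𝟙 M.X := rfl

/-- Composition of morphisms of models. [folklore] -/
def Hom.comp (ψ : Hom L N) (φ : Hom N M) : Hom L M where
  f := ψ.f ≫ φ.f
  f_π := by rw [Category.assoc, φ.f_π, ψ.f_π]
  gen_f := by rw [← Category.assoc, ψ.gen_f, φ.gen_f]

/-- The underlying morphism of a composite. [folklore] -/
@[simp] theorem Hom.comp_f (ψ : Hom L N) (φ : Hom N M) : (ψ.comp φ).f = ψ.f ≫ φ.f := rfl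

/-- A morphism of projective models is a morphism of the associated proper models. [folklore] -/
def _root_.Literature.AlgebraicGeometry.Resolution.ProjModel.Hom.toProperModel
    {N' M' : ProjModel k K} (φ : N'.Hom M') : Hom N'.toProperModel M'.toProperModel := φ

/-- **Centres map to centres** under a morphism of models. [cite: ZariskiSamuel1960, Ch. VI §17] -/
theorem Hom.map_centre (φ : Hom N M) (v : ZariskiRiemannSpace k K) :
    φ.f (N.centre v) = M.centre v :=
  eq_centre_of_isCentre ((N.isCentre_centre v).map φ)

/-- The underlying morphism of a morphism of proper models is proper. [folklore] -/
instance Hom.isProper (φ : Hom N M) : IsProper φ.f := by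
  haveI : IsProper (φ.f ≫ M.π) := by rw [φ.f_π]; infer_instance
  exact IsProper.of_comp φ.f M.π

/-- **`φ⁻¹(Reg M) ⊆ Reg N`** (Piltant 2013, Prop. 5.1: `πᵢ⁻¹(Reg_P(Xᵢ)) ⊆ Reg_P(Y)`).
[cite: Piltant2013, Prop. 5.1] -/
def Hom.RegLe (φ : Hom N M) : Prop :=
  ∀ y : N.X, IsRegularLocalRing (M.X.presheaf.stalk (φ.f y)) →
    IsRegularLocalRing (N.X.presheaf.stalk y)

/-- Regular centres lift along morphisms with `φ⁻¹(Reg M) ⊆ Reg N`. [folklore] -/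
theorem RegCentre.of_hom (φ : Hom N M) (hφ : φ.RegLe) {v : ZariskiRiemannSpace k K}
    (h : M.RegCentre v) : N.RegCentre v := by
  apply hφ
  rw [φ.map_centre v]
  exact h

/-- `RegLe` is stable under composition. [folklore] -/
theorem Hom.RegLe.comp {ψ : Hom L N} {φ : Hom N M} (hψ : ψ.RegLe) (hφ : φ.RegLe) :
    (ψ.comp φ).RegLe :=
  fun y h => hψ y (hφ (ψ.f y) (by rwa [Hom.comp_f, Scheme.Hom.comp_apply] at h))

/-- The identity is `RegLe`. [folklore] -/
theorem Hom.RegLe.id (M : ProperModel k K) : (Hom.id M).RegLe := fun _ h => h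

/-! ## Morphisms of models are birational -/

/-- The range of the `K`-point of a proper model is the generic point. [folklore] -/
theorem range_gen (M : ProperModel k K) : Set.range M.gen = {genericPoint M.X} := by
  ext z
  constructor
  · rintro ⟨p, rfl⟩
    rw [ProjModel.eq_closedPoint_of_field p]
    exact M.genericPt_eq
  · intro hz
    exact ⟨closedPoint K, M.genericPt_eq.trans (Set.mem_singleton_iff.mp hz).symm⟩

/-- The `K`-point of a proper model is dominant. [folklore] -/
instance isDominant_gen (M : ProperModel k K) : IsDominant M.gen := by
  refine ⟨?_⟩
  show Dense (Set.range M.gen)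
  rw [range_gen, dense_iff_closure_eq]
  exact genericPoint_spec M.X

/-- **Uniqueness of domination**: two morphisms of proper models `N → M` have the same underlying
morphism. [cite: ZariskiSamuel1960, Ch. VI §17] -/
theorem Hom.f_eq (φ ψ : Hom N M) : φ.f = ψ.f :=
  ext_of_isDominant_of_isSeparated M.π (by rw [φ.f_π, ψ.f_π]) N.gen (by rw [φ.gen_f, ψ.gen_f])

/-- **A morphism of proper models of the same field is birational**: it is an isomorphism over a
non-empty open of the target, with dense preimage (spreading out the `K`-point of the source to a
dominant section, Stacks 0BX6; proof verbatim that of `ProjModel.Hom.exists_isIso_morphismRestrict`).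
[cite: StacksProject, Tag 0BX6] -/
theorem Hom.exists_isIso_morphismRestrict (φ : Hom N M) :
    ∃ U : M.X.Opens, (U : Set M.X).Nonempty ∧ IsIso (φ.f ∣_ U) ∧
      Dense ((φ.f ⁻¹ᵁ U : N.X.Opens) : Set N.X) := by
  haveI : IsSeparated (φ.f ≫ M.π) := by rw [φ.f_π]; infer_instance
  haveI : IsSeparated φ.f := IsSeparated.of_comp φ.f M.π
  haveI : LocallyOfFiniteType (φ.f ≫ M.π) := by rw [φ.f_π]; infer_instance
  haveI : LocallyOfFiniteType φ.f := locallyOfFiniteType_of_comp φ.f M.π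
  set x : M.X := M.gen (closedPoint K) with hxdef
  let e : M.X.presheaf.stalk x ≅ CommRingCat.of K := asIso (Scheme.stalkClosedPointTo M.gen)
  let g : Spec (M.X.presheaf.stalk x) ⟶ N.X := Spec.map e.inv ≫ N.gen
  have he : Spec.map e.hom ≫ M.X.fromSpecStalk x = M.gen :=
    Scheme.Spec_stalkClosedPointTo_fromSpecStalk M.gen
  have hg : g ≫ φ.f = M.X.fromSpecStalk x ≫ 𝟙 M.X := by
    rw [Category.comp_id, Category.assoc, φ.gen_f, ← he, ← Category.assoc, ← Spec.map_comp,
      Iso.hom_inv_id, Spec.map_id, Category.id_comp]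
  obtain ⟨U, hxU, s, hs₁, hs₂⟩ :=
    spread_out_of_isGermInjective' (sX := 𝟙 M.X) (sY := φ.f) g hg
  rw [Category.comp_id] at hs₂
  have hpt : U.fromSpecStalkOfMem x hxU (closedPoint (M.X.presheaf.stalk x)) = ⟨x, hxU⟩ := by
    apply U.ι.injective
    rw [← Scheme.Hom.comp_apply, Scheme.Opens.fromSpecStalkOfMem_ι, Scheme.fromSpecStalk_closedPoint]
    rfl
  have hsx : s ⟨x, hxU⟩ = genericPoint N.X := by
    have h1 : g (closedPoint (M.X.presheaf.stalk x)) = s ⟨x, hxU⟩ := by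
      rw [hs₁, Scheme.Hom.comp_apply, hpt]
    rw [← h1]
    change N.gen (Spec.map e.inv (closedPoint _)) = _
    rw [ProjModel.eq_closedPoint_of_field (Spec.map e.inv (closedPoint _))]
    exact N.genericPt_eq
  haveI : IsDominant s := by
    refine ⟨dense_iff_closure_eq.mpr (Set.eq_univ_of_univ_subset ?_)⟩
    have h := (genericPoint_spec N.X).def
    rw [← hsx] at h
    calc (Set.univ : Set N.X) = closure {s ⟨x, hxU⟩} := h.symm
      _ ⊆ closure (Set.range s) := closure_mono (Set.singleton_subset_iff.mpr ⟨_, rfl⟩)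
  obtain ⟨hiso, hdense⟩ := ChowLemmaProof.isIso_morphismRestrict_of_section φ.f U s hs₂
  exact ⟨U, ⟨x, hxU⟩, hiso, hdense⟩

/-- A morphism of proper models is birational (`IsBirational`). [folklore] -/
theorem Hom.isBirational (φ : Hom N M) : IsBirational φ.f := by
  obtain ⟨U, hU, hiso, hdense⟩ := φ.exists_isIso_morphismRestrict
  exact ⟨U, U.2.dense hU, hdense, hiso⟩

/-- **A proper model dominated by a regular proper model has a resolution of singularities.**
[cite: ZariskiSamuel1960, Ch. VI §17] -/
theorem Hom.hasResolution (φ : Hom N M) (hN : Scheme.IsRegular N.X) :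
    Scheme.HasResolution M.X := by
  obtain ⟨U, hU, hiso, -⟩ := φ.exists_isIso_morphismRestrict
  exact hasResolution_of_isIso_morphismRestrict φ.f hN U (U.2.dense hU) hiso

/-! ## Zariski's patching of a finite resolving system -/

/-- **Patching a finite resolving system from the weak two-model step** (Zariski 1944,
Fundamental Theorem p. 539; Piltant 2013, Cor. 5.7: "By applying `n − 1` consecutive times
proposition 5.1"): if for any two proper models there is a proper model over the first on which
every valuation with a regular centre on either has a regular centre, then for every `M₀` and
every finite list of proper models there is a proper model `N → M₀` on which every valuation with a
regular centre on `M₀` or on some member of the list has a regular centre.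
[cite: Piltant2013, Cor. 5.7] -/
theorem exists_hom_forall_regCentre
    (hZ : ∀ M₁ M₂ : ProperModel k K, ∃ (N : ProperModel k K) (_ : N.Hom M₁),
      ∀ v : ZariskiRiemannSpace k K, (M₁.RegCentre v ∨ M₂.RegCentre v) → N.RegCentre v)
    (M₀ : ProperModel k K) :
    ∀ l : List (ProperModel k K), ∃ (N : ProperModel k K) (_ : N.Hom M₀),
      ∀ v : ZariskiRiemannSpace k K,
        (M₀.RegCentre v ∨ ∃ M ∈ l, M.RegCentre v) → N.RegCentre v
  | [] => ⟨M₀, Hom.id M₀, fun v h => h.elim (fun h0 => h0) fun ⟨_, hM, _⟩ => by simp at hM⟩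
  | M :: l => by
    obtain ⟨N, φ, hN⟩ := exists_hom_forall_regCentre hZ M₀ l
    obtain ⟨N', ψ, hN'⟩ := hZ N M
    refine ⟨N', ψ.comp φ, fun v hv => ?_⟩
    rcases hv with h0 | ⟨M', hM', hreg⟩
    · exact hN' v (Or.inl (hN v (Or.inl h0)))
    · rcases List.mem_cons.mp hM' with rfl | hl
      · exact hN' v (Or.inr hreg)
      · exact hN' v (Or.inl (hN v (Or.inr ⟨M', hl, hreg⟩)))

/-- **Zariski's patching programme for one proper model**: under the weak two-model step, if
every valuation ring of `K/k` has a regular centre on SOME member of a finite family of proper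
models, then every proper model `M₀` is dominated by a REGULAR proper model, hence has a
resolution of singularities. [cite: Piltant2013, Cor. 5.7] -/
theorem hasResolution_of_resolvingSystem
    (hZ : ∀ M₁ M₂ : ProperModel k K, ∃ (N : ProperModel k K) (_ : N.Hom M₁),
      ∀ v : ZariskiRiemannSpace k K, (M₁.RegCentre v ∨ M₂.RegCentre v) → N.RegCentre v)
    (M₀ : ProperModel k K) (l : List (ProperModel k K))
    (hcov : ∀ v : ZariskiRiemannSpace k K, ∃ M ∈ l, M.RegCentre v) :
    Scheme.HasResolution M₀.X := by
  obtain ⟨N, φ, hN⟩ := exists_hom_forall_regCentre hZ M₀ l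
  exact φ.hasResolution (isRegular_of_forall_regCentre fun v => hN v (Or.inr (hcov v)))

/-- The two-model step in Piltant's form (`N → M₁`, `N → M₂` with `φᵢ⁻¹(Reg Mᵢ) ⊆ Reg N`,
Prop. 5.1 for `P = P_reg`) implies the weak two-model step. [cite: Piltant2013, Prop. 5.1] -/
theorem weakStep_of_regLe
    (hZ : ∀ M₁ M₂ : ProperModel k K,
      ∃ (N : ProperModel k K) (φ₁ : N.Hom M₁) (φ₂ : N.Hom M₂), φ₁.RegLe ∧ φ₂.RegLe)
    (M₁ M₂ : ProperModel k K) :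
    ∃ (N : ProperModel k K) (_ : N.Hom M₁),
      ∀ v : ZariskiRiemannSpace k K, (M₁.RegCentre v ∨ M₂.RegCentre v) → N.RegCentre v := by
  obtain ⟨N, φ₁, φ₂, h₁, h₂⟩ := hZ M₁ M₂
  exact ⟨N, φ₁, fun v hv => hv.elim (RegCentre.of_hom φ₁ h₁) (RegCentre.of_hom φ₂ h₂)⟩

/-- **Zariski's patching programme, Piltant's form, proper models**: two-model patching with
`RegLe` + a finite resolving system of proper models ⇒ every proper model has a resolution.
[cite: Piltant2013, Prop. 5.1 and Cor. 5.7] -/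
theorem hasResolution_of_resolvingSystem_of_regLe
    (hZ : ∀ M₁ M₂ : ProperModel k K,
      ∃ (N : ProperModel k K) (φ₁ : N.Hom M₁) (φ₂ : N.Hom M₂), φ₁.RegLe ∧ φ₂.RegLe)
    (M₀ : ProperModel k K) (l : List (ProperModel k K))
    (hcov : ∀ v : ZariskiRiemannSpace k K, ∃ M ∈ l, M.RegCentre v) :
    Scheme.HasResolution M₀.X :=
  hasResolution_of_resolvingSystem (weakStep_of_regLe hZ) M₀ l hcov

end ProperModel

end Literature.AlgebraicGeometry.Resolution

end
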